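import Summits.AtomisticToContinuum.FouriersLaw.Theses.VanishingNoiseTransfer
import Summits.AtomisticToContinuum.FouriersLaw.Theorems.VanishingNoiseTransferNoisyFourierFlipNessExistsUnique
import Summits.AtomisticToContinuum.FouriersLaw.Theorems.VanishingNoiseTransferNoisyFourierFlipFiniteResponse
import Summits.AtomisticToContinuum.FouriersLaw.Theorems.VanishingNoiseTransferNoisyFourierFlipPositiveConductance
import Summits.AtomisticToContinuum.FouriersLaw.Theorems.VanishingNoiseTransferNoisyFourierFlipConductanceCeiling
import Summits.AtomisticToContinuum.FouriersLaw.Theorems.NoisyFourier.Negative.GluingShellTightness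

/-!
# `NoisyFourier` from the series law alone (line `sector-dirichlet-gluing`, end of cycle c1)

Crux `VanishingNoiseTransfer.NoisyFourier` (stmt-AtomisticToContinuum-11977). The line's skeleton
(`Cruxes/NoisyFourier/Lines/sector_dirichlet_gluing.lean`) has ONE open stub left, the series law for the
bath-to-bath resistances `R_N = (N−1)/D_N` of the flip chain (`stub_resistanceGluing`:
`∃ C', ∀ N M ≥ 2, R_{N+M} ≤ R_N + R_M + C'`, under uniqueness, along every flip-steady family, given positivity).
Everything else is LANDED: clause (i) (`flipNessExistsUnique`, p85824 + p118995 + p121372 + p122517), the fixed-`N`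
response (`stub_flipFiniteResponse`, p120199), its positivity (`stub_flipPositiveConductance`, p120329), the
Fourier-type ceiling (`stub_flipConductanceCeiling`), and the refuter's real-analysis step
(`Drefute.tendsto_pos_of_resistanceGluing_of_bdd`). This file makes the reduction IMPORTABLE:
`noisyFourier_of_resistanceGluing : (series law) → NoisyFourier` — a proof of the series law closes the crux by one
`exact`. The assembly lemmas are the skeleton's (canonical family by choice, transfer to every family by uniqueness).
No definitions; no sorry; the theorem is an implication (the crux itself stays open).
-/

noncomputable section

namespace Summit.AtomisticToContinuum.FouriersLaw.Theorems.NoisyFourier.LineAssembly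

open Filter Topology MeasureTheory
open Literature.MathematicalPhysics.KineticTheory.HeatConduction
open Summit.AtomisticToContinuum.FouriersLaw.Cruxes.NoisyFourier

/-! ## Assembly: from the canonical family to `FlipFouriersLawFor` (proved) -/

/-- Clause (i) in its `∃ μ, … ∧ ∀ ν, … → ν = μ` form, from the two halves Stub 1a (existence)
and Stub 1b (uniqueness). [folklore] -/
theorem existsUnique_of_exists_of_unique
    (hE : ∀ ω₂ lam β γ : ℝ, 0 < ω₂ → 0 < lam → 0 < β → 0 < γ → ∀ ε : ℝ, 0 < ε →
      ∀ (N : ℕ) (T_L T_R : ℝ), 0 < T_L → 0 < T_R →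
        ∃ μ : MeasureTheory.Measure
            (Literature.MathematicalPhysics.KineticTheory.HeatConduction.PhaseSpace N),
          (Literature.MathematicalPhysics.KineticTheory.HeatConduction.pinnedChain
              ω₂ lam β γ).IsFlipSteadyState N T_L T_R ε μ)
    (hU : ∀ ω₂ lam β γ : ℝ, 0 < ω₂ → 0 < lam → 0 < β → 0 < γ → ∀ ε : ℝ, 0 < ε →
      ∀ (N : ℕ) (T_L T_R : ℝ), 0 < T_L → 0 < T_R →
        ∀ μ ν : MeasureTheory.Measure
            (Literature.MathematicalPhysics.KineticTheory.HeatConduction.PhaseSpace N),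
          (Literature.MathematicalPhysics.KineticTheory.HeatConduction.pinnedChain
              ω₂ lam β γ).IsFlipSteadyState N T_L T_R ε μ →
          (Literature.MathematicalPhysics.KineticTheory.HeatConduction.pinnedChain
              ω₂ lam β γ).IsFlipSteadyState N T_L T_R ε ν → μ = ν) :
    ∀ ω₂ lam β γ : ℝ, 0 < ω₂ → 0 < lam → 0 < β → 0 < γ → ∀ ε : ℝ, 0 < ε →
      ∀ (N : ℕ) (T_L T_R : ℝ), 0 < T_L → 0 < T_R →
        ∃ μ : MeasureTheory.Measure
            (Literature.MathematicalPhysics.KineticTheory.HeatConduction.PhaseSpace N),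
          (Literature.MathematicalPhysics.KineticTheory.HeatConduction.pinnedChain
              ω₂ lam β γ).IsFlipSteadyState N T_L T_R ε μ ∧
          ∀ ν : MeasureTheory.Measure
              (Literature.MathematicalPhysics.KineticTheory.HeatConduction.PhaseSpace N),
            (Literature.MathematicalPhysics.KineticTheory.HeatConduction.pinnedChain
                ω₂ lam β γ).IsFlipSteadyState N T_L T_R ε ν → ν = μ := by
  intro ω₂ lam β γ hω hl hβ hγ ε hε N T_L T_R hL hR
  obtain ⟨μ, hμ⟩ := hE ω₂ lam β γ hω hl hβ hγ ε hε N T_L T_R hL hR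
  exact ⟨μ, hμ, fun ν hν => hU ω₂ lam β γ hω hl hβ hγ ε hε N T_L T_R hL hR ν μ hν hμ⟩

/-- Uniqueness of flip steady states in the `∀ μ ν` form, from the `∃!` form of Stub 1. -/
theorem uniq_of_existsUnique {P : OscillatorChain} {ε : ℝ}
    (hEU : ∀ (N : ℕ) (T_L T_R : ℝ), 0 < T_L → 0 < T_R →
      ∃ μ : Measure (PhaseSpace N), P.IsFlipSteadyState N T_L T_R ε μ ∧
        ∀ ν : Measure (PhaseSpace N), P.IsFlipSteadyState N T_L T_R ε ν → ν = μ) :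
    ∀ (N : ℕ) (T_L T_R : ℝ), 0 < T_L → 0 < T_R → ∀ μ ν : Measure (PhaseSpace N),
      P.IsFlipSteadyState N T_L T_R ε μ → P.IsFlipSteadyState N T_L T_R ε ν → μ = ν := by
  intro N T_L T_R hL hR μ ν hμ hν
  obtain ⟨μ₀, -, hμ₀⟩ := hEU N T_L T_R hL hR
  rw [hμ₀ μ hμ, hμ₀ ν hν]

/-- **Assembly lemma.** Clause (i) plus, for every flip-steady family and every `T > 0`, response
coefficients converging to a positive limit, give `FlipFouriersLawFor`: `κ_ε(T)` is read off the
canonical family (choice), and uniqueness makes the response quotients of any flip-steady family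
agree with the canonical ones for `|δ| < 2T` (`Filter.Tendsto.congr'`), as in
`FeketeSeriesLaw.closes`. -/
theorem flipFouriersLawFor_of_canonical (P : OscillatorChain) (ε : ℝ)
    (hEU : ∀ (N : ℕ) (T_L T_R : ℝ), 0 < T_L → 0 < T_R →
      ∃ μ : Measure (PhaseSpace N), P.IsFlipSteadyState N T_L T_R ε μ ∧
        ∀ ν : Measure (PhaseSpace N), P.IsFlipSteadyState N T_L T_R ε ν → ν = μ)
    (hlim : ∀ μ : (N : ℕ) → ℝ → ℝ → Measure (PhaseSpace N),
      (∀ (N : ℕ) (T_L T_R : ℝ), 0 < T_L → 0 < T_R → P.IsFlipSteadyState N T_L T_R ε (μ N T_L T_R)) →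
      ∀ T : ℝ, 0 < T → ∃ κT : ℝ, 0 < κT ∧ ∃ D : ℕ → ℝ,
        (∀ N : ℕ, Tendsto (fun δ : ℝ => P.totalCurrent (μ N (T + δ / 2) (T - δ / 2)) / δ)
          (𝓝[≠] 0) (𝓝 (D N))) ∧ Tendsto D atTop (𝓝 κT)) :
    P.FlipFouriersLawFor ε := by
  have huniq := uniq_of_existsUnique hEU
  refine ⟨hEU, ?_⟩
  classical
  -- the canonical family (junk at non-positive temperatures)
  let μ₀ : (N : ℕ) → ℝ → ℝ → Measure (PhaseSpace N) := fun N T_L T_R =>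
    if h : 0 < T_L ∧ 0 < T_R then Classical.choose (hEU N T_L T_R h.1 h.2) else 0
  have hμ₀ : ∀ (N : ℕ) (T_L T_R : ℝ), 0 < T_L → 0 < T_R →
      P.IsFlipSteadyState N T_L T_R ε (μ₀ N T_L T_R) := by
    intro N T_L T_R hL hR
    simp only [μ₀, dif_pos (And.intro hL hR)]
    exact (Classical.choose_spec (hEU N T_L T_R hL hR)).1
  have key := hlim μ₀ hμ₀
  choose κf hκpos Df hDf hDlim using key
  refine ⟨fun T => if hT : 0 < T then κf T hT else 1, fun T hT => ?_, ?_⟩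
  · simp only [dif_pos hT]
    exact hκpos T hT
  intro μ hμ T hT
  refine ⟨Df T hT, fun N => ?_, ?_⟩
  · refine (hDf T hT N).congr' ?_
    have h2 : ∀ᶠ δ in 𝓝 (0 : ℝ), δ < 2 * T := eventually_lt_nhds (by linarith)
    have h2' : ∀ᶠ δ in 𝓝 (0 : ℝ), -(2 * T) < δ := eventually_gt_nhds (by linarith)
    filter_upwards [mem_nhdsWithin_of_mem_nhds h2, mem_nhdsWithin_of_mem_nhds h2'] with δ hlt hgt
    have ha : 0 < T + δ / 2 := by linarith
    have hb : 0 < T - δ / 2 := by linarith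
    rw [huniq N _ _ ha hb (μ₀ N _ _) (μ N _ _) (hμ₀ N _ _ ha hb) (hμ N _ _ ha hb)]
  · simp only [dif_pos hT]
    exact hDlim T hT

/-! ## The composition (sorry-free): the stub statements ⇒ the crux in its Literature form -/

/-- **`flipFouriersLawFor_of_gluing`** — THE COMPOSITION with explicit hypotheses (sorry-free, axioms
propext / Classical.choice / Quot.sound): the statements of Stubs 1–5 imply
`∀ parameters > 0, ∀ ε > 0, (pinnedChain …).FlipFouriersLawFor ε`, which is the crux
`VanishingNoiseTransfer.NoisyFourier` up to `rfl` (`noisyFourier_iff_flipFouriersLawFor`).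
Per `ε, T > 0`, along the canonical flip-steady family: Stub 2 gives `D_N`, Stub 3 `D_N > 0`
(`N ≥ 2`), Stub 4′ a ceiling `D_N ≤ K`, Stub 5 quasi-subadditive resistances; the refuter's landed
`Drefute.tendsto_pos_of_resistanceGluing_of_bdd` (Fekete on `{N ≥ 2}` for `R_N = (N−1)/D_N`, lower bound
`R_N/N ≥ ((N−1)/N)/K`) gives `D_N → s > 0`; `flipFouriersLawFor_of_canonical` assembles clause (ii)
for every family by uniqueness (Stub 1). -/
theorem flipFouriersLawFor_of_gluing
    (hEU : (∀ ω₂ lam β γ : ℝ, 0 < ω₂ → 0 < lam → 0 < β → 0 < γ → ∀ ε : ℝ, 0 < ε →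
      ∀ (N : ℕ) (T_L T_R : ℝ), 0 < T_L → 0 < T_R →
        ∃ μ : MeasureTheory.Measure
            (Literature.MathematicalPhysics.KineticTheory.HeatConduction.PhaseSpace N),
          (Literature.MathematicalPhysics.KineticTheory.HeatConduction.pinnedChain
              ω₂ lam β γ).IsFlipSteadyState N T_L T_R ε μ ∧
          ∀ ν : MeasureTheory.Measure
              (Literature.MathematicalPhysics.KineticTheory.HeatConduction.PhaseSpace N),
            (Literature.MathematicalPhysics.KineticTheory.HeatConduction.pinnedChain
                ω₂ lam β γ).IsFlipSteadyState N T_L T_R ε ν → ν = μ))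
    (hFR : (∀ ω₂ lam β γ : ℝ, 0 < ω₂ → 0 < lam → 0 < β → 0 < γ → ∀ ε : ℝ, 0 < ε →
      (∀ (N : ℕ) (T_L T_R : ℝ), 0 < T_L → 0 < T_R →
        ∀ μ ν : MeasureTheory.Measure
            (Literature.MathematicalPhysics.KineticTheory.HeatConduction.PhaseSpace N),
          (Literature.MathematicalPhysics.KineticTheory.HeatConduction.pinnedChain
              ω₂ lam β γ).IsFlipSteadyState N T_L T_R ε μ →
          (Literature.MathematicalPhysics.KineticTheory.HeatConduction.pinnedChain
              ω₂ lam β γ).IsFlipSteadyState N T_L T_R ε ν → μ = ν) →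
      ∀ μ : (N : ℕ) → ℝ → ℝ → MeasureTheory.Measure
          (Literature.MathematicalPhysics.KineticTheory.HeatConduction.PhaseSpace N),
        (∀ (N : ℕ) (T_L T_R : ℝ), 0 < T_L → 0 < T_R →
          (Literature.MathematicalPhysics.KineticTheory.HeatConduction.pinnedChain
              ω₂ lam β γ).IsFlipSteadyState N T_L T_R ε (μ N T_L T_R)) →
        ∀ T : ℝ, 0 < T → ∀ N : ℕ, ∃ D : ℝ,
          Filter.Tendsto (fun δ : ℝ =>
            (Literature.MathematicalPhysics.KineticTheory.HeatConduction.pinnedChain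
                ω₂ lam β γ).totalCurrent (μ N (T + δ / 2) (T - δ / 2)) / δ)
            (nhdsWithin 0 {(0 : ℝ)}ᶜ) (nhds D)))
    (hP : (∀ ω₂ lam β γ : ℝ, 0 < ω₂ → 0 < lam → 0 < β → 0 < γ → ∀ ε : ℝ, 0 < ε →
      (∀ (N : ℕ) (T_L T_R : ℝ), 0 < T_L → 0 < T_R →
        ∀ μ ν : MeasureTheory.Measure
            (Literature.MathematicalPhysics.KineticTheory.HeatConduction.PhaseSpace N),
          (Literature.MathematicalPhysics.KineticTheory.HeatConduction.pinnedChain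
              ω₂ lam β γ).IsFlipSteadyState N T_L T_R ε μ →
          (Literature.MathematicalPhysics.KineticTheory.HeatConduction.pinnedChain
              ω₂ lam β γ).IsFlipSteadyState N T_L T_R ε ν → μ = ν) →
      ∀ μ : (N : ℕ) → ℝ → ℝ → MeasureTheory.Measure
          (Literature.MathematicalPhysics.KineticTheory.HeatConduction.PhaseSpace N),
        (∀ (N : ℕ) (T_L T_R : ℝ), 0 < T_L → 0 < T_R →
          (Literature.MathematicalPhysics.KineticTheory.HeatConduction.pinnedChain
              ω₂ lam β γ).IsFlipSteadyState N T_L T_R ε (μ N T_L T_R)) →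
        ∀ T : ℝ, 0 < T → ∀ D : ℕ → ℝ,
          (∀ N : ℕ, Filter.Tendsto (fun δ : ℝ =>
            (Literature.MathematicalPhysics.KineticTheory.HeatConduction.pinnedChain
                ω₂ lam β γ).totalCurrent (μ N (T + δ / 2) (T - δ / 2)) / δ)
            (nhdsWithin 0 {(0 : ℝ)}ᶜ) (nhds (D N))) →
          ∀ N : ℕ, 2 ≤ N → 0 < D N))
    (hK : (∀ ω₂ lam β γ : ℝ, 0 < ω₂ → 0 < lam → 0 < β → 0 < γ → ∀ ε : ℝ, 0 < ε →
      (∀ (N : ℕ) (T_L T_R : ℝ), 0 < T_L → 0 < T_R →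
        ∀ μ ν : MeasureTheory.Measure
            (Literature.MathematicalPhysics.KineticTheory.HeatConduction.PhaseSpace N),
          (Literature.MathematicalPhysics.KineticTheory.HeatConduction.pinnedChain
              ω₂ lam β γ).IsFlipSteadyState N T_L T_R ε μ →
          (Literature.MathematicalPhysics.KineticTheory.HeatConduction.pinnedChain
              ω₂ lam β γ).IsFlipSteadyState N T_L T_R ε ν → μ = ν) →
      ∀ μ : (N : ℕ) → ℝ → ℝ → MeasureTheory.Measure
          (Literature.MathematicalPhysics.KineticTheory.HeatConduction.PhaseSpace N),
        (∀ (N : ℕ) (T_L T_R : ℝ), 0 < T_L → 0 < T_R →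
          (Literature.MathematicalPhysics.KineticTheory.HeatConduction.pinnedChain
              ω₂ lam β γ).IsFlipSteadyState N T_L T_R ε (μ N T_L T_R)) →
        ∀ T : ℝ, 0 < T → ∀ D : ℕ → ℝ,
          (∀ N : ℕ, Filter.Tendsto (fun δ : ℝ =>
            (Literature.MathematicalPhysics.KineticTheory.HeatConduction.pinnedChain
                ω₂ lam β γ).totalCurrent (μ N (T + δ / 2) (T - δ / 2)) / δ)
            (nhdsWithin 0 {(0 : ℝ)}ᶜ) (nhds (D N))) →
          ∃ K : ℝ, ∀ N : ℕ, 2 ≤ N → D N ≤ K))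
    (hR : (∀ ω₂ lam β γ : ℝ, 0 < ω₂ → 0 < lam → 0 < β → 0 < γ → ∀ ε : ℝ, 0 < ε →
      (∀ (N : ℕ) (T_L T_R : ℝ), 0 < T_L → 0 < T_R →
        ∀ μ ν : MeasureTheory.Measure
            (Literature.MathematicalPhysics.KineticTheory.HeatConduction.PhaseSpace N),
          (Literature.MathematicalPhysics.KineticTheory.HeatConduction.pinnedChain
              ω₂ lam β γ).IsFlipSteadyState N T_L T_R ε μ →
          (Literature.MathematicalPhysics.KineticTheory.HeatConduction.pinnedChain
              ω₂ lam β γ).IsFlipSteadyState N T_L T_R ε ν → μ = ν) →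
      ∀ μ : (N : ℕ) → ℝ → ℝ → MeasureTheory.Measure
          (Literature.MathematicalPhysics.KineticTheory.HeatConduction.PhaseSpace N),
        (∀ (N : ℕ) (T_L T_R : ℝ), 0 < T_L → 0 < T_R →
          (Literature.MathematicalPhysics.KineticTheory.HeatConduction.pinnedChain
              ω₂ lam β γ).IsFlipSteadyState N T_L T_R ε (μ N T_L T_R)) →
        ∀ T : ℝ, 0 < T → ∀ D : ℕ → ℝ,
          (∀ N : ℕ, Filter.Tendsto (fun δ : ℝ =>
            (Literature.MathematicalPhysics.KineticTheory.HeatConduction.pinnedChain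
                ω₂ lam β γ).totalCurrent (μ N (T + δ / 2) (T - δ / 2)) / δ)
            (nhdsWithin 0 {(0 : ℝ)}ᶜ) (nhds (D N))) →
          (∀ N : ℕ, 2 ≤ N → 0 < D N) →
          ∃ C : ℝ, ∀ N M : ℕ, 2 ≤ N → 2 ≤ M →
            (((N + M : ℕ) : ℝ) - 1) / D (N + M) ≤
              ((N : ℝ) - 1) / D N + ((M : ℝ) - 1) / D M + C)) :
    ∀ ω₂ lam β γ : ℝ, 0 < ω₂ → 0 < lam → 0 < β → 0 < γ → ∀ ε : ℝ, 0 < ε →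
      (Literature.MathematicalPhysics.KineticTheory.HeatConduction.pinnedChain
          ω₂ lam β γ).FlipFouriersLawFor ε := by
  intro ω₂ lam β γ hω hl hβ hγ ε hε
  refine flipFouriersLawFor_of_canonical (pinnedChain ω₂ lam β γ) ε
    (hEU ω₂ lam β γ hω hl hβ hγ ε hε) fun μ hμ T hT => ?_
  have huniq := uniq_of_existsUnique (hEU ω₂ lam β γ hω hl hβ hγ ε hε)
  have hDex := hFR ω₂ lam β γ hω hl hβ hγ ε hε huniq μ hμ T hT
  choose D hD using hDex
  have hpos : ∀ N : ℕ, 2 ≤ N → 0 < D N := hP ω₂ lam β γ hω hl hβ hγ ε hε huniq μ hμ T hT D hD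
  obtain ⟨K, hK'⟩ := hK ω₂ lam β γ hω hl hβ hγ ε hε huniq μ hμ T hT D hD
  obtain ⟨C', hC'⟩ := hR ω₂ lam β γ hω hl hβ hγ ε hε huniq μ hμ T hT D hD hpos
  obtain ⟨s, hs0, hDs⟩ := Drefute.tendsto_pos_of_resistanceGluing_of_bdd hpos hK' hC'
  exact ⟨s, hs0, D, hD, hDs⟩

/-- **The crux is `FlipFouriersLawFor` at every `ε > 0`** (= Disproof §0 `noisyFourier_iff`,
re-proved here so that the skeleton is self-contained): the route's inlined steady-state
predicate is `OscillatorChain.IsFlipSteadyState` by `rfl` (`isFlipSteadyState_fun_eq`). -/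
theorem noisyFourier_iff_flipFouriersLawFor :
    Summit.AtomisticToContinuum.FouriersLaw.Theses.VanishingNoiseTransfer.NoisyFourier ↔
      (∀ ω₂ lam β γ : ℝ, 0 < ω₂ → 0 < lam → 0 < β → 0 < γ → ∀ ε : ℝ, 0 < ε →
      (Literature.MathematicalPhysics.KineticTheory.HeatConduction.pinnedChain
          ω₂ lam β γ).FlipFouriersLawFor ε) := by
  constructor
  · intro h ω₂ lam β γ hω hl hβ hγ ε hε
    exact h ω₂ lam β γ hω hl hβ hγ _ rfl ε hε
  · intro h ω₂ lam β γ hω hl hβ hγ S hS ε hε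
    subst hS
    exact h ω₂ lam β γ hω hl hβ hγ ε hε


/-! ## The crux from the series law -/

/-- **`NoisyFourier` from the series law for the resistances.** If, for all admissible parameters and every
`ε > 0`, under uniqueness of flip steady states and along every flip-steady family, the bath-to-bath resistances
`R_N = (N−1)/D_N` of positive response coefficients satisfy `R_{N+M} ≤ R_N + R_M + C'` (`N, M ≥ 2`) — the statement
of the line's last open stub `stub_resistanceGluing` — then the crux `VanishingNoiseTransfer.NoisyFourier` holds:
clause (i), the fixed-`N` response, its positivity and the ceiling `D_N ≤ K` are landed theorems, and Fekete on
`{N ≥ 2}` (`Drefute.tendsto_pos_of_resistanceGluing_of_bdd`) gives `D_N → s > 0`. -/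
theorem noisyFourier_of_resistanceGluing : (∀ ω₂ lam β γ : ℝ, 0 < ω₂ → 0 < lam → 0 < β → 0 < γ → ∀ ε : ℝ, 0 < ε → (∀ (N : ℕ) (T_L T_R : ℝ), 0 < T_L → 0 < T_R → ∀ μ ν : MeasureTheory.Measure (Literature.MathematicalPhysics.KineticTheory.HeatConduction.PhaseSpace N), (Literature.MathematicalPhysics.KineticTheory.HeatConduction.pinnedChain ω₂ lam β γ).IsFlipSteadyState N T_L T_R ε μ → (Literature.MathematicalPhysics.KineticTheory.HeatConduction.pinnedChain ω₂ lam β γ).IsFlipSteadyState N T_L T_R ε ν → μ = ν) → ∀ μ : (N : ℕ) → ℝ → ℝ → MeasureTheory.Measure (Literature.MathematicalPhysics.KineticTheory.HeatConduction.PhaseSpace N), (∀ (N : ℕ) (T_L T_R : ℝ), 0 < T_L → 0 < T_R → (Literature.MathematicalPhysics.KineticTheory.HeatConduction.pinnedChain ω₂ lam β γ).IsFlipSteadyState N T_L T_R ε (μ N T_L T_R)) → ∀ T : ℝ, 0 < T → ∀ D : ℕ → ℝ, (∀ N : ℕ, Filter.Tendsto (fun δ : ℝ => (Literature.MathematicalPhysics.KineticTheory.HeatConduction.pinnedChain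 ω₂ lam β γ).totalCurrent (μ N (T + δ / 2) (T - δ / 2)) / δ) (nhdsWithin 0 {(0 : ℝ)}ᶜ) (nhds (D N))) → (∀ N : ℕ, 2 ≤ N → 0 < D N) → ∃ C : ℝ, ∀ N M : ℕ, 2 ≤ N → 2 ≤ M → (((N + M : ℕ) : ℝ) - 1) / D (N + M) ≤ ((N : ℝ) - 1) / D N + ((M : ℝ) - 1) / D M + C) → Summit.AtomisticToContinuum.FouriersLaw.Theses.VanishingNoiseTransfer.NoisyFourier :=
  fun hR =>
  noisyFourier_iff_flipFouriersLawFor.2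
    (flipFouriersLawFor_of_gluing
      (existsUnique_of_exists_of_unique SectorDirichletGluing.stub_flipNessExists SectorDirichletGluing.flipNessUnique)
      SectorDirichletGluing.stub_flipFiniteResponse SectorDirichletGluing.stub_flipPositiveConductance
      SectorDirichletGluing.stub_flipConductanceCeiling hR)

end Summit.AtomisticToContinuum.FouriersLaw.Theorems.NoisyFourier.LineAssembly

end
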